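import Literature.NumberTheory.ConnesConsani2021.ArchKernelTier2PanelsSound
import Literature.NumberTheory.ConnesConsani2021.ArchKernelS8Identity
import Literature.NumberTheory.ConnesConsani2021.ArchKernelS8Truncation
import Literature.NumberTheory.ConnesConsani2021.ArchKernelSonineFrobenius
import Literature.NumberTheory.ConnesConsani2021.EpsSlopeTailFrame
import Literature.Analysis.ValidatedNumerics.TaylorModelPanelOps
import Literature.Analysis.ValidatedNumerics.TaylorModelLinComb
import HarnessLib

/-!
# (E-a) Tier 2 — (O-a) `tmem_s8TM`: the Taylor-model let-chain of cc-iso's `s8TM` is SOUND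

LINE 1 — FRAMING: RH-FREE certified-numerics soundness (cell rh-crit, corpus C1; bears_on W-C/W-P, route
«ConnesConsaniSemilocal» item K3 `WindowSpectralBound`, stmt-RiemannHypothesis-19306).  WHAT THIS IS NOT: a
statement about prolate functions, a certificate value, or any claim about RH — nothing here bears on the
truth of RH.

For the LANDED data module `ArchKernelTier2Panels.lean` (seat cc-iso g4, p447146): if real families
`C i j`, `cFs j`, `cFu i` are enclosed entrywise by `combinedLit` (seat eng-1 g2's (B2)
`ArchKernelTier2CombineSound.combinedLit_encloses`), the centre `c` is enclosed by `Cc`, and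
`s8TM hQ 6 Cc combinedLit = some P`, then `P` is a Taylor model on `|w| ≤ hQ` of
`w ↦ e^{3(c+w)/2}·((1−e^{−(c+w)})·Σ_{i<24}(Σ_{j<34} C i j (1−e^{c+w})^j)(1−e^{−(c+w)})^i + Σ_{j<34} cFs j (1−e^{c+w})^j)
     − e^{−3(c+w)/2}·Σ_{i<24} cFu i (1−e^{−(c+w)})^i + δ(w)`
for EVERY perturbation `δ` with `|δ(w)|·S ≤ combinedLit.W` on `|w| ≤ hQ` (the `widen0 … W` slot) — i.e. of
the right-hand side of t4 g4's (B1) `S8Identity.sum_trunc_exp_eq_model (c + w) … 8 24 34` plus `δ`.  The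
proof replays the `let`-chain of `s8TM` with the generic bricks `tmem_exp_mul_add_of_exp_eq_some`,
`mem_mul_ofRat`, `tmem_powers`, `tmem_linComb`, `tmem_mul_foldl_zipIdx_mul_powers` (t4 g4,
`TaylorModelPanelOps` / `TaylorModelLinComb`) and `TaylorModel` arithmetic; `ArchCertT2.tlinComb/tpowers`
are `PolyMP.tlinComb/tpowers S` by `rfl`.  Draft: seat rh-crit-cc-eng-1 g2 (cc/drafts/eng1_ArchKernelTier2S8Sound.lean,
14:31Z); completed by seat t4 g4 (cc-lead R131/R132 consortium).  Theorems only; 0 definitions, 0 facts.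

PART 2 (assembly, seat t4 g4): `tmem_s8TM_sonine` — for every panel `k` and output `P` of
`s8TM hQ 6 (centre k) combinedLit` there is `E` with `TMem S hQ E P` that EQUALS the mode sum
`w ↦ S8 (e^{c_k+w}) = Σ_{n<8} τ(n)T_n(e^{c_k+w})` whenever `c_k + w ∈ [0, log 2]`, given per mode the
identification `prolateFun n = frobEvenExt (b n)` with `u_{b n}′(0) = 0`, `t n = epsSlopeTerm ψ_n`, the (B2)
enclosures of the `t`-contracted data, the five truncation sup-bounds and the allowance inequality
`Σ_n t n·(√2(δG·A + B·δo) + δi + 2√2·δo) ≤ W/S` (all as hypotheses on real families); uses (B1)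
`S8Identity.sum_trunc_eq_model`, (B3) `S8Identity.abs_bracket_sub_truncPoly_le`, t7 g3's
`sonineQTerm_prolateFun_eq_frob` / `continuousOn_frobSol₁_Ioo`.  The ∃E form is forced by `hQ > log 2/128`
(for `e^{c₀+w} < 1` the tree's `sonineQTerm` is not the eq.-(99) bracket); the frame only evaluates on `[0, log 2]`,
so `hM_of_subSups_exists` / `tier2_hM_of_exists` (cc-iso g4's `hM_of_subSups` / `tier2_hM_of` of
`ArchKernelTier2PanelsSound.lean` with the S₈ input in ∃E form, same proof) conclude the SAME `hM`, and
`h8_of_s8TM` packages the ∃E input for the panels of record.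

References: the modelled quantity is the mode sum of CC2021 §5 eq. (99) p. 32 in the additive variable of
eq. (101) p. 33, for the §6.3 kernel `ϖ` p. 24 [cite: ConnesConsani2021, §5 eq. (99) p. 32; §6.3 p. 24];
Taylor-model arithmetic [cite: MakinoBerz2003, Def 2–3, Thm 2].
-/

namespace Literature.NumberTheory.ConnesConsani2021.ArchCertT2

open Literature.Analysis.ValidatedNumerics Literature.Analysis.ValidatedNumerics.NumericsMP
  Literature.Analysis.ValidatedNumerics.PolyMP Literature.NumberTheory.ConnesConsani2021.ArchCert Finset
open Literature.NumberTheory.ConnesConsani2021.ArchCertSigma (hQ sigmaTM)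

/-- `1 ∈ oneI`. [cite: ConnesConsani2021, §6.3 p. 24 (in-kernel (E-a) certificate)] -/
theorem mem_oneI : MI.mem S (1 : ℝ) oneI := by simpa [oneI] using MI.mem_ofInt S 1

/-- A Taylor model widened in its constant coefficient absorbs any perturbation `|δ ρ|·S ≤ e`. [cite: MakinoBerz2003, Def 2 (addition of Taylor models; the remainder interval)] -/
theorem tmem_widen0 {h : ℚ} {f δ : ℝ → ℝ} {P : IPoly} {e : ℤ} (hf : TMem S h f P)
    (hδ : ∀ ρ : ℝ, |ρ| ≤ (h : ℝ) → |δ ρ| * S ≤ e) : TMem S h (fun ρ ↦ f ρ + δ ρ) (widen0 P e) := fun ρ hρ ↦ by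
  obtain ⟨as, has, ef⟩ := hf ρ hρ
  obtain ⟨bs, hbs, eb⟩ := exists_widen0 has (hδ ρ hρ) ρ
  exact ⟨bs, hbs, by show f ρ + δ ρ = evalR bs ρ; rw [eb, ef]⟩

/-- `texpAt` is sound: for `c ∈ Cc` and `|q·h| ≤ 1`, `texpAt h 9 q Cc = some R` encloses `w ↦ e^{q(c+w)}`
(t4 g4's corollary of `tmem_exp_mul_add_of_exp_eq_some`). [cite: MakinoBerz2003, Def 3 «Exponential» eq. (2.2)] -/
theorem texpAt_tmem {h q : ℚ} {c : ℝ} {Cc : MI} {R : IPoly} (hqh : |q * h| ≤ 1) (hc : MI.mem S c Cc)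
    (hR : texpAt h 9 q Cc = some R) : TMem S h (fun w ↦ Real.exp (q * (c + w))) R := by
  unfold texpAt at hR
  split at hR
  · simp at hR
  · rename_i E hE
    simp only [Option.some.injEq] at hR
    subst hR
    exact tmem_exp_mul_add_of_exp_eq_some ArchCert.S_pos (by norm_num) hqh (mem_mul_ofRat ArchCert.S_pos hc q) hE

/-- `combinedLit` has `24` rows of `34` entries, `cFs` has `34`, `cFu` has `24`, `(Kin, Kout) = (24, 34)`. [cite: ConnesConsani2021, Prop. 5.3 p. 32 (in-kernel (E-a) certificate)] -/
theorem combinedLit_shape : combinedLit.C.length = 24 ∧ (∀ i < 24, (combinedLit.C.getD i []).length = 34) ∧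
    combinedLit.cFs.length = 34 ∧ combinedLit.cFu.length = 24 ∧ combinedLit.Kin = 24 ∧ combinedLit.Kout = 34 := by
  refine ⟨by decide, ?_, by decide, by decide, by decide, by decide⟩
  decide

/-- **`tmem_s8TM`**: the let-chain of `s8TM hQ 6 Cc combinedLit` encloses the model polynomial (the RHS of
`S8Identity.sum_trunc_exp_eq_model (c + w) … 8 24 34`) plus `δ`, for every entrywise-enclosed data `C, cFs, cFu`,
centre `c ∈ Cc` and perturbation `|δ(w)|·S ≤ W` on `|w| ≤ hQ`.
[cite: ConnesConsani2021, §5 eq. (99) p. 32 and §6.3 p. 24 (the modelled kernel); MakinoBerz2003, Thm 2 (FTTMA)] -/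
theorem tmem_s8TM {c : ℝ} {Cc : MI} (hc : MI.mem S c Cc) {P : IPoly} (hP : s8TM hQ 6 Cc combinedLit = some P)
    {C : ℕ → ℕ → ℝ} {cFs cFu : ℕ → ℝ}
    (hC : ∀ i < 24, ∀ j < 34, MI.mem S (C i j) ((combinedLit.C.getD i []).getD j zeroI))
    (hFs : ∀ j < 34, MI.mem S (cFs j) (combinedLit.cFs.getD j zeroI))
    (hFu : ∀ i < 24, MI.mem S (cFu i) (combinedLit.cFu.getD i zeroI))
    {δ : ℝ → ℝ} (hδ : ∀ w : ℝ, |w| ≤ ((hQ : ℚ) : ℝ) → |δ w| * S ≤ combinedLit.W) :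
    TMem S hQ (fun w ↦
      (Real.exp (3 / 2 * (c + w)) *
          ((1 - Real.exp (-(c + w))) * ∑ i ∈ range 24, (∑ j ∈ range 34, C i j * (1 - Real.exp (c + w)) ^ j) *
              (1 - Real.exp (-(c + w))) ^ i + ∑ j ∈ range 34, cFs j * (1 - Real.exp (c + w)) ^ j) -
        Real.exp (-(3 / 2 * (c + w))) * ∑ i ∈ range 24, cFu i * (1 - Real.exp (-(c + w))) ^ i) + δ w) P := by
  obtain ⟨hClen, hrow, hFslen, hFulen, hKin, hKout⟩ := combinedLit_shape
  have hQv : hQ = 5416 / 10 ^ 6 := rfl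
  have h0 : (0 : ℚ) ≤ hQ := by rw [hQv]; norm_num
  have hq32 : |(3 / 2 : ℚ) * hQ| ≤ 1 := by rw [hQv, abs_le]; constructor <;> norm_num
  have hqm32 : |(-3 / 2 : ℚ) * hQ| ≤ 1 := by rw [hQv, abs_le]; constructor <;> norm_num
  have hq1 : |(1 : ℚ) * hQ| ≤ 1 := by rw [hQv, abs_le]; constructor <;> norm_num
  have hqm1 : |(-1 : ℚ) * hQ| ≤ 1 := by rw [hQv, abs_le]; constructor <;> norm_num
  unfold s8TM at hP
  cases h32 : texpAt hQ 9 (3 / 2) Cc with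
  | none => simp [h32] at hP
  | some R32 =>
  cases hm32 : texpAt hQ 9 (-3 / 2) Cc with
  | none => simp [h32, hm32] at hP
  | some Rm32 =>
  cases h1 : texpAt hQ 9 1 Cc with
  | none => simp [h32, hm32, h1] at hP
  | some R1 =>
  cases hm1 : texpAt hQ 9 (-1) Cc with
  | none => simp [h32, hm32, h1, hm1] at hP
  | some Rm1 =>
  simp only [h32, hm32, h1, hm1, Option.some.injEq] at hP
  subst hP
  -- the four exponentials
  have eR32 := texpAt_tmem hq32 hc h32
  have eRm32 := texpAt_tmem hqm32 hc hm32
  have eR1 := texpAt_tmem hq1 hc h1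
  have eRm1 := texpAt_tmem hqm1 hc hm1
  -- U = 1 − e^{−(c+w)}, NS = 1 − e^{c+w}
  have eU : TMem S hQ (fun w ↦ 1 - Real.exp (-(c + w))) (tsubI (tconst oneI) Rm1) :=
    (tmem_sub (tmem_const mem_oneI) eRm1).congr fun w _ ↦ by push_cast; ring_nf
  have eNS : TMem S hQ (fun w ↦ 1 - Real.exp (c + w)) (tsubI (tconst oneI) R1) :=
    (tmem_sub (tmem_const mem_oneI) eR1).congr fun w _ ↦ by push_cast; ring_nf
  set U : IPoly := tsubI (tconst oneI) Rm1 with hUdef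
  set NS : IPoly := tsubI (tconst oneI) R1 with hNSdef
  -- powers
  have ePowNS : ∀ (j : ℕ) (hj : j < (PolyMP.tpowers S hQ 6 NS combinedLit.Kout).length),
      TMem S hQ (fun w ↦ (1 - Real.exp (c + w)) ^ j) (PolyMP.tpowers S hQ 6 NS combinedLit.Kout)[j] := by
    intro j hj
    rw [length_tpowers] at hj
    rw [List.getElem_eq_getD []]
    exact tmem_powers ArchCert.S_pos h0 eNS _ (by omega)
  have ePowU : ∀ (i : ℕ) (hi : i < (PolyMP.tpowers S hQ 6 U combinedLit.Kin).length),
      TMem S hQ (fun w ↦ (1 - Real.exp (-(c + w))) ^ i) (PolyMP.tpowers S hQ 6 U combinedLit.Kin)[i] := by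
    intro i hi
    rw [length_tpowers] at hi
    rw [List.getElem_eq_getD []]
    exact tmem_powers ArchCert.S_pos h0 eU _ (by omega)
  -- rows
  have eRows : ∀ (i : ℕ) (hi : i < (combinedLit.C.map fun row ↦ PolyMP.tlinComb S row (PolyMP.tpowers S hQ 6 NS combinedLit.Kout)).length),
      TMem S hQ (fun w ↦ ∑ j ∈ range 34, C i j * (1 - Real.exp (c + w)) ^ j)
        (combinedLit.C.map fun row ↦ PolyMP.tlinComb S row (PolyMP.tpowers S hQ 6 NS combinedLit.Kout))[i] := by
    intro i hi
    rw [List.length_map] at hi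
    have hi24 : i < 24 := hClen ▸ hi
    rw [List.getElem_map]
    have hrowi : combinedLit.C[i] = combinedLit.C.getD i [] := (List.getD_eq_getElem _ _ hi).symm
    have hlen : (combinedLit.C[i]).length = 34 := by rw [hrowi]; exact hrow i hi24
    have key := tmem_linComb (S := S) (h := hQ) ArchCert.S_pos (cs := combinedLit.C[i]) (Ps := PolyMP.tpowers S hQ 6 NS combinedLit.Kout)
      (c := fun j ↦ C i j) (f := fun j w ↦ (1 - Real.exp (c + w)) ^ j)
      (fun j hj ↦ by
        have hj34 : j < 34 := hlen ▸ hj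
        have e2 : (combinedLit.C[i])[j] = (combinedLit.C.getD i []).getD j zeroI := by
          rw [List.getElem_eq_getD zeroI, hrowi]
        rw [e2]
        exact hC i hi24 j hj34)
      ePowNS
    refine key.congr fun w _ ↦ ?_
    rw [hlen, length_tpowers, hKout, show min 34 (34 + 1) = 34 by norm_num]
  -- J = U · Σ_i rows_i U^i
  have eJ := tmem_mul_foldl_zipIdx_mul_powers (D := 6) (m := combinedLit.Kin) ArchCert.S_pos h0 eRows eU
    (by rw [List.length_map, hClen, hKin]; norm_num) (by rw [hKin]; norm_num)
  -- Fs, Fu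
  have eFs := tmem_linComb (S := S) (h := hQ) ArchCert.S_pos (cs := combinedLit.cFs) (Ps := PolyMP.tpowers S hQ 6 NS combinedLit.Kout)
      (c := cFs) (f := fun j w ↦ (1 - Real.exp (c + w)) ^ j)
      (fun j hj ↦ by rw [List.getElem_eq_getD zeroI]; exact hFs j (hFslen ▸ hj)) ePowNS
  have eFu := tmem_linComb (S := S) (h := hQ) ArchCert.S_pos (cs := combinedLit.cFu) (Ps := PolyMP.tpowers S hQ 6 U combinedLit.Kin)
      (c := cFu) (f := fun i w ↦ (1 - Real.exp (-(c + w))) ^ i)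
      (fun i hi ↦ by rw [List.getElem_eq_getD zeroI]; exact hFu i (hFulen ▸ hi)) ePowU
  -- assemble
  have m34 : min combinedLit.cFs.length (PolyMP.tpowers S hQ 6 NS combinedLit.Kout).length = 34 := by
    rw [hFslen, length_tpowers, hKout]; norm_num
  have m24 : min combinedLit.cFu.length (PolyMP.tpowers S hQ 6 U combinedLit.Kin).length = 24 := by
    rw [hFulen, length_tpowers, hKin]; norm_num
  have l24 : (combinedLit.C.map fun row ↦
      PolyMP.tlinComb S row (PolyMP.tpowers S hQ 6 NS combinedLit.Kout)).length = 24 := by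
    rw [List.length_map, hClen]
  rw [m34] at eFs
  rw [m24] at eFu
  rw [l24] at eJ
  have eMain := tmem_sub (tmem_mul ArchCert.S_pos h0 6 eR32 (tmem_add eJ eFs)) (tmem_mul ArchCert.S_pos h0 6 eRm32 eFu)
  refine (tmem_widen0 eMain hδ).congr fun w _ ↦ ?_
  push_cast
  ring_nf


/-! ## Part 2 — the analytic assembly: `s8TM` encloses `S₈ ∘ exp` on `[0, log 2]` (∃E form)

On the panel of centre `c_k = (2k+1)·log 2/128`, the Taylor model `s8TM hQ 6 (centre k) combinedLit` encloses a
function `E` that AGREES with `w ↦ Σ_{n<8} τ(n)T_n(e^{c_k+w})` whenever `c_k + w ∈ [0, log 2]` (the only points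
the frame `section6_enclosures_of_tier2` evaluates).  The ∃E form is forced: `hQ` exceeds `log 2/128` by
`7.9·10⁻⁷`, and for `e^{c₀+w} < 1` the tree's `sonineQTerm` is not the eq.-(99) bracket (cc/STATUS 14:33Z).
Inputs, all as HYPOTHESES on real families so that the file does not wait on oleans: per-mode identification
`prolateFun n = frobEvenExt (b n)`, `u_{b n}′(0) = 0` (gm-t16's `modes_identified_mem`), `t n = epsSlopeTerm ψ_n`,
the entrywise enclosures of the contracted data ((B2), eng-1's `combinedLit_encloses`), the five per-mode
sup-bounds and the allowance inequality ((F), gm-t16's `ArchKernelS8TruncationBounds`); used: (O-a) above,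
(B1) `S8Identity.sum_trunc_eq_model`, (B3) `S8Identity.abs_bracket_sub_truncPoly_le`, t7's
`sonineQTerm_prolateFun_eq_frob` / `continuousOn_frobSol₁_Ioo`. -/

section Assembly

open Literature.NumberTheory.LFunctions Literature.NumberTheory.ConnesConsani2021.S8Identity
open Set MeasureTheory intervalIntegral
open scoped Nat

/-- **`τ(n)T_n = t(n) · bracket`**: t7's eq.-(99) identity with the prefactor written as `epsSlopeTerm ψ_n`.
[cite: ConnesConsani2021, §5 eq. (99) p. 32; Lemma 5.4 p. 33] -/
theorem sonineQTerm_eq_epsSlopeTerm_mul {b : ℝ} {n : ℕ} (hB : frobSol₁ 1 b 0 = 0)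
    (h : prolateFun n = frobEvenExt b) {ρ : ℝ} (hρ : ρ ∈ Icc (1 : ℝ) 2) :
    sonineQTerm (prolateFun n) (prolateEigen n) ρ =
      epsSlopeTerm (prolateFun n) *
        (ρ ^ (1 / 2 : ℝ) * (∫ x in ρ⁻¹..1, (x * frobSol₁ 1 b x) * (ρ * x * frobSol₁ 1 b (ρ * x)))
          + ρ ^ (-(3 / 2) : ℝ) * frobSol₁ 1 b ρ⁻¹ - ρ ^ (3 / 2 : ℝ) * frobSol₁ 1 b ρ) := by
  rw [sonineQTerm_prolateFun_eq_frob hB h hρ]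
  unfold epsSlopeTerm
  rw [show prolateLambda (prolateFun n) = prolateEigen n from rfl]
  ring

/-- **T2b-sound (∃E form).**  For every panel `k` and every output `P` of `s8TM hQ 6 (centre k) combinedLit`,
there is `E` with `TMem S hQ E P` and `E w = Σ_{n<8} τ(n)T_n(e^{c_k + w})` whenever `c_k + w ∈ [0, log 2]`
(`c_k = (2k+1)·log 2/128`) — given, per mode `n < 8`: a critical `b n` with `prolateFun n = frobEvenExt (b n)`,
`t n = epsSlopeTerm ψ_n`, coefficient families `f n`, `g n` whose `t`-contractions are enclosed by
`combinedLit` (`hC`, `hFs`, `hFu`), the five truncation sup-bounds `δG, δi, B` (inner range `[½,1]`) and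
`δo, A` (outer range `[1,2]`), and the allowance inequality `Σ_n t n·(√2(δG·A + B·δo) + δi + 2√2·δo) ≤ W/S`.
[cite: ConnesConsani2021, §5 eq. (99) p. 32 and §6.3 p. 24 (in-kernel (E-a) certificate of the §6 kernel enclosure); MakinoBerz2003, Thm 2 (FTTMA)] -/
theorem tmem_s8TM_sonine (k : ℕ) {P : IPoly} (hP : s8TM hQ 6 (centre k) combinedLit = some P)
    {b t : ℕ → ℝ} {f g : ℕ → ℕ → ℝ}
    (hBc : ∀ n, n < 8 → frobSol₁ 1 (b n) 0 = 0) (hid : ∀ n, n < 8 → prolateFun n = frobEvenExt (b n))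
    (ht : ∀ n, n < 8 → t n = epsSlopeTerm (prolateFun n))
    (hC : ∀ i < 24, ∀ j < 34,
      MI.mem S (∑ n ∈ range 8, t n * g n i * f n j * ((i ! * j ! : ℝ) / (i + j + 1)!))
        ((combinedLit.C.getD i []).getD j zeroI))
    (hFs : ∀ j < 34, MI.mem S (∑ n ∈ range 8, t n * f n j) (combinedLit.cFs.getD j zeroI))
    (hFu : ∀ i < 24, MI.mem S (∑ n ∈ range 8, t n * f n i) (combinedLit.cFu.getD i zeroI))
    {δG δi δo A B : ℕ → ℝ}
    (hGd : ∀ n, n < 8 → ∀ x ∈ Icc (1 / 2 : ℝ) 1,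
      |x ^ 2 * frobSol₁ 1 (b n) x + ∑ i ∈ range 24, g n i * (1 - x) ^ i| ≤ δG n)
    (hFi : ∀ n, n < 8 → ∀ x ∈ Icc (1 / 2 : ℝ) 1,
      |frobSol₁ 1 (b n) x + ∑ i ∈ range 24, f n i * (1 - x) ^ i| ≤ δi n)
    (hGs : ∀ n, n < 8 → ∀ x ∈ Icc (1 / 2 : ℝ) 1, |∑ i ∈ range 24, g n i * (1 - x) ^ i| ≤ B n)
    (hFo : ∀ n, n < 8 → ∀ y ∈ Icc (1 : ℝ) 2,
      |frobSol₁ 1 (b n) y + ∑ j ∈ range 34, f n j * (1 - y) ^ j| ≤ δo n)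
    (hA : ∀ n, n < 8 → ∀ y ∈ Icc (1 : ℝ) 2, |frobSol₁ 1 (b n) y| ≤ A n)
    (hW : ∑ n ∈ range 8, t n * (Real.sqrt 2 * (δG n * A n + B n * δo n) + δi n + 2 * Real.sqrt 2 * δo n)
      ≤ (combinedLit.W : ℝ) / S) :
    ∃ E : ℝ → ℝ, TMem S hQ E P ∧
      ∀ w : ℝ, 0 ≤ cK k + w → cK k + w ≤ Real.log 2 → E w = S8 (Real.exp (cK k + w)) := by
  have hS : (0 : ℝ) < S := by exact_mod_cast ArchCert.S_pos
  set c : ℝ := cK k with hc_def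
  -- the model polynomial (RHS of (B1) at `v`) and the mode sum
  set M : ℝ → ℝ := fun v ↦ Real.exp (3 / 2 * v) *
      ((1 - Real.exp (-v)) * ∑ i ∈ range 24, (∑ j ∈ range 34,
          (∑ n ∈ range 8, t n * g n i * f n j * ((i ! * j ! : ℝ) / (i + j + 1)!)) * (1 - Real.exp v) ^ j) *
          (1 - Real.exp (-v)) ^ i + ∑ j ∈ range 34, (∑ n ∈ range 8, t n * f n j) * (1 - Real.exp v) ^ j) -
    Real.exp (-(3 / 2 * v)) * ∑ i ∈ range 24, (∑ n ∈ range 8, t n * f n i) * (1 - Real.exp (-v)) ^ i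
    with hM_def
  set S8e : ℝ → ℝ := fun v ↦ ∑ n ∈ range 8, sonineQTerm (prolateFun n) (prolateEigen n) (Real.exp v)
    with hS8_def
  -- the key estimate on `[0, log 2]`
  have est : ∀ v : ℝ, 0 ≤ v → v ≤ Real.log 2 → |S8e v - M v| * S ≤ combinedLit.W := by
    intro v hv0 hv1
    set ρ : ℝ := Real.exp v with hρ_def
    have hρ : ρ ∈ Icc (1 : ℝ) 2 := by
      refine ⟨Real.one_le_exp hv0, ?_⟩
      calc Real.exp v ≤ Real.exp (Real.log 2) := Real.exp_le_exp.2 hv1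
        _ = 2 := Real.exp_log two_pos
    have hρ0 : ρ ≠ 0 := (Real.exp_pos v).ne'
    -- per-mode: |τT_n(ρ) − t n · TRUNC_n(ρ)| ≤ t n · bound_n
    have hmode : ∀ n, n < 8 →
        |sonineQTerm (prolateFun n) (prolateEigen n) ρ -
          t n * (ρ ^ (3 / 2 : ℝ) *
              ((∫ x in ρ⁻¹..(1 : ℝ), (∑ i ∈ range 24, g n i * (1 - x) ^ i) *
                  (∑ j ∈ range 34, f n j * (1 - ρ * x) ^ j)) +
                ∑ j ∈ range 34, f n j * (1 - ρ) ^ j) -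
            ρ ^ (-(3 / 2) : ℝ) * ∑ i ∈ range 24, f n i * (1 - ρ⁻¹) ^ i)|
          ≤ t n * (Real.sqrt 2 * (δG n * A n + B n * δo n) + δi n + 2 * Real.sqrt 2 * δo n) := by
      intro n hn
      have ht0 : 0 ≤ t n := by rw [ht n hn]; exact epsSlopeTerm_prolateFun_nonneg n
      have hcont := continuousOn_frobSol₁_Ioo (b n)
      have hu'in : ContinuousOn (frobSol₁ 1 (b n)) (Icc (1 / 2) 1) :=
        hcont.mono fun x hx ↦ ⟨by linarith [hx.1], by linarith [hx.2]⟩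
      have hu'out : ContinuousOn (frobSol₁ 1 (b n)) (Icc 1 2) :=
        hcont.mono fun x hx ↦ ⟨by linarith [hx.1], by linarith [hx.2]⟩
      have hb3 := abs_bracket_sub_truncPoly_le (Kin := 24) (Kout := 34) hu'in hu'out
        (hGd n hn) (hFi n hn) (hGs n hn) (hFo n hn) (hA n hn) hρ
      rw [sonineQTerm_eq_epsSlopeTerm_mul (hBc n hn) (hid n hn) hρ, ← ht n hn, ← mul_sub, abs_mul,
        abs_of_nonneg ht0]
      exact mul_le_mul_of_nonneg_left hb3 ht0
    -- sum over the modes and the Beta identity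
    have hsum := abs_sum_sub_sum_le_of_le (N := 8) hmode
    have hmodel := sum_trunc_eq_model hρ0 t g f 8 24 34
    have e1 : ρ ^ (3 / 2 : ℝ) = Real.exp (3 / 2 * v) := by
      rw [hρ_def, ← Real.exp_mul]; ring_nf
    have e2 : ρ ^ (-(3 / 2) : ℝ) = Real.exp (-(3 / 2 * v)) := by
      rw [hρ_def, ← Real.exp_mul]; ring_nf
    have e3 : ρ⁻¹ = Real.exp (-v) := by rw [hρ_def]; exact (Real.exp_neg v).symm
    have hMv : M v = ∑ n ∈ range 8, t n * (ρ ^ (3 / 2 : ℝ) *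
        ((∫ x in ρ⁻¹..(1 : ℝ), (∑ i ∈ range 24, g n i * (1 - x) ^ i) *
            (∑ j ∈ range 34, f n j * (1 - ρ * x) ^ j)) +
          ∑ j ∈ range 34, f n j * (1 - ρ) ^ j) -
        ρ ^ (-(3 / 2) : ℝ) * ∑ i ∈ range 24, f n i * (1 - ρ⁻¹) ^ i) := by
      rw [hmodel, hM_def]
      simp only []
      rw [e1, e2, e3]
    have hS8v : S8e v = ∑ n ∈ range 8, sonineQTerm (prolateFun n) (prolateEigen n) ρ := by
      rw [hS8_def]
    rw [hS8v, hMv]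
    have hle : |(∑ n ∈ range 8, sonineQTerm (prolateFun n) (prolateEigen n) ρ) -
        ∑ n ∈ range 8, t n * (ρ ^ (3 / 2 : ℝ) *
          ((∫ x in ρ⁻¹..(1 : ℝ), (∑ i ∈ range 24, g n i * (1 - x) ^ i) *
              (∑ j ∈ range 34, f n j * (1 - ρ * x) ^ j)) +
            ∑ j ∈ range 34, f n j * (1 - ρ) ^ j) -
          ρ ^ (-(3 / 2) : ℝ) * ∑ i ∈ range 24, f n i * (1 - ρ⁻¹) ^ i)| ≤ (combinedLit.W : ℝ) / S :=
      hsum.trans hW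
    have := mul_le_mul_of_nonneg_right hle hS.le
    rwa [div_mul_cancel₀ _ hS.ne'] at this
  -- nonnegativity of `W` (from `hW`: its left side is ≥ 0)
  have hW0 : (0 : ℝ) ≤ combinedLit.W := by
    have h1 : (1 : ℝ) ∈ Icc (1 / 2 : ℝ) 1 := ⟨by norm_num, le_rfl⟩
    have h1' : (1 : ℝ) ∈ Icc (1 : ℝ) 2 := ⟨le_rfl, one_le_two⟩
    have hs : 0 ≤ ∑ n ∈ range 8,
        t n * (Real.sqrt 2 * (δG n * A n + B n * δo n) + δi n + 2 * Real.sqrt 2 * δo n) := by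
      refine Finset.sum_nonneg fun n hn ↦ ?_
      have hn8 : n < 8 := Finset.mem_range.1 hn
      have ht0 : 0 ≤ t n := by rw [ht n hn8]; exact epsSlopeTerm_prolateFun_nonneg n
      have hδG : 0 ≤ δG n := le_trans (abs_nonneg _) (hGd n hn8 1 h1)
      have hδi : 0 ≤ δi n := le_trans (abs_nonneg _) (hFi n hn8 1 h1)
      have hB0 : 0 ≤ B n := le_trans (abs_nonneg _) (hGs n hn8 1 h1)
      have hδo : 0 ≤ δo n := le_trans (abs_nonneg _) (hFo n hn8 1 h1')
      have hA0 : 0 ≤ A n := le_trans (abs_nonneg _) (hA n hn8 1 h1')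
      positivity
    have h := hs.trans hW
    have := mul_nonneg h hS.le
    rwa [div_mul_cancel₀ _ hS.ne'] at this
  -- the enclosed function: S₈∘exp on the range, the model outside
  refine ⟨fun w ↦ if 0 ≤ c + w ∧ c + w ≤ Real.log 2 then S8e (c + w) else M (c + w), ?_, ?_⟩
  · have hδ : ∀ w : ℝ, |w| ≤ ((hQ : ℚ) : ℝ) →
        |(if 0 ≤ c + w ∧ c + w ≤ Real.log 2 then S8e (c + w) else M (c + w)) - M (c + w)| * S
          ≤ combinedLit.W := by
      intro w _
      by_cases hr : 0 ≤ c + w ∧ c + w ≤ Real.log 2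
      · rw [if_pos hr]; exact est _ hr.1 hr.2
      · rw [if_neg hr, sub_self, abs_zero, zero_mul]; exact hW0
    have key := tmem_s8TM (mem_centre k) hP
      (C := fun i j ↦ ∑ n ∈ range 8, t n * g n i * f n j * ((i ! * j ! : ℝ) / (i + j + 1)!))
      (cFs := fun j ↦ ∑ n ∈ range 8, t n * f n j) (cFu := fun i ↦ ∑ n ∈ range 8, t n * f n i)
      hC hFs hFu hδ
    refine key.congr fun w _ ↦ ?_
    show M (c + w) + ((if 0 ≤ c + w ∧ c + w ≤ Real.log 2 then S8e (c + w) else M (c + w)) - M (c + w)) =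
      (if 0 ≤ c + w ∧ c + w ≤ Real.log 2 then S8e (c + w) else M (c + w))
    ring
  · intro w h0 h1
    show (if 0 ≤ c + w ∧ c + w ≤ Real.log 2 then S8e (c + w) else M (c + w)) = S8 (Real.exp (c + w))
    rw [if_pos ⟨h0, h1⟩, hS8_def, S8]


/-! ### The read-back `hM` with the T2b input in ∃E form

cc-iso g4's `hM_of_subSups` / `tier2_hM_of` (`ArchKernelTier2PanelsSound.lean`) take the S₈ Taylor-model input in
the literal form `TMem S hQ (fun u ↦ S8 (e^{c_K+u})) (s8 K)`, which no one can supply for `K = 0` (above); the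
variants below take it in the ∃E form that `tmem_s8TM_sonine` delivers and conclude the SAME `hM` (the frame only
evaluates at `w ∈ [0, log 2]`).  Proof = cc-iso's, with `E` in place of `S8 ∘ exp` until the last line. -/

/-- **The read-back, generic in the data, ∃E form of the S₈ input.** [cite: ConnesConsani2021, §6.4 Fact 6.1 + Lemma 6.3 p. 24 (in-kernel (E-a) certificate); §6.3 p. 24] -/
theorem hM_of_subSups_exists (s8 : ℕ → IPoly) (table : List (List ℤ))
    (hP : ∀ K < 64, subSups (tsubI (sigmaTM K) (s8 K)) = table.getD K [])
    (hσ : ∀ K < 64, TMem S hQ (fun u ↦ 2 * ((twoEt / 2 : ℚ) : ℝ) * (tauC (cK K + u)).re) (sigmaTM K))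
    (h8 : ∀ K < 64, ∃ E : ℝ → ℝ, TMem S hQ E (s8 K) ∧
      ∀ u : ℝ, 0 ≤ cK K + u → cK K + u ≤ Real.log 2 → E u = S8 (Real.exp (cK K + u))) :
    ∀ k : ℕ, k < 2048 → ∀ w ∈ Icc ((k : ℝ) * Real.log 2 / 2048) (((k + 1 : ℕ) : ℝ) * Real.log 2 / 2048),
      |2 * ((twoEt / 2 : ℚ) : ℝ) * (tauC w).re - S8 (Real.exp w)|
        ≤ ((((table.getD (k / 32) []).getD (k % 32) 0 : ℚ) / (S : ℚ) : ℚ) : ℝ) := by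
  intro k hk w hw
  set K := k / 32 with hKdef
  set s := k % 32 with hsdef
  have hK : K < 64 := by omega
  have hs32 : s < 32 := Nat.mod_lt _ (by norm_num)
  have hPK := hP K hK
  set SM := s8 K with hSMdef
  obtain ⟨E, hE, hEeq⟩ := h8 K hK
  -- `w ∈ [0, log 2]`
  have hL0 : 0 < Real.log 2 := Real.log_pos one_lt_two
  have hw0 : 0 ≤ w := le_trans (by positivity) hw.1
  have hw1 : w ≤ Real.log 2 := by
    refine hw.2.trans ?_
    have hk1 : ((k + 1 : ℕ) : ℝ) ≤ 2048 := by exact_mod_cast hk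
    calc ((k + 1 : ℕ) : ℝ) * Real.log 2 / 2048 ≤ 2048 * Real.log 2 / 2048 := by
          exact div_le_div_of_nonneg_right (mul_le_mul_of_nonneg_right hk1 hL0.le) (by norm_num)
      _ = Real.log 2 := by ring
  -- the model of the difference on the coarse panel
  have hG : TMem S hQ (fun u ↦ 2 * ((twoEt / 2 : ℚ) : ℝ) * (tauC (cK K + u)).re - E u)
      (tsubI (sigmaTM K) SM) := tmem_sub (hσ K hK) hE
  -- re-centred to the sub-panel and bounded by `tabsI`
  have hsh := tmem_shift hG (mem_offset s) (abs_oS_add_hs_le hs32)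
  have hy := abs_local_le hw
  rw [← hKdef, ← hsdef] at hy
  have hbound := abs_le_tabsI (by norm_num [hs]) hsh hy
  -- identify the table entry
  have hrow : (subSups (tsubI (sigmaTM K) SM)).getD s 0 =
      tabsI S hs (shiftI S (tsubI (sigmaTM K) SM) (offset s)) := by
    simp only [subSups, List.getD_eq_getElem?_getD, List.getElem?_map, List.getElem?_range hs32,
      Option.map_some, Option.getD_some]
  have h1 : (table.getD K []).getD s 0 = tabsI S hs (shiftI S (tsubI (sigmaTM K) SM) (offset s)) := by
    rw [← hPK, hrow]
  have hSpos : (0 : ℝ) < (S : ℝ) := by exact_mod_cast ArchCert.S_pos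
  rw [h1]
  push_cast
  rw [le_div_iff₀ hSpos]
  have e : oS s + (w - cK K - oS s) = w - cK K := by ring
  have e2 : cK K + (w - cK K) = w := by ring
  have hEw : E (w - cK K) = S8 (Real.exp w) := by
    rw [hEeq (w - cK K) (by rw [e2]; exact hw0) (by rw [e2]; exact hw1), e2]
  rw [e] at hbound; rw [e2, hEw] at hbound
  push_cast at hbound ⊢
  exact hbound

/-- **The read-back `hM` for the table of record `panelM`, ∃E form of the S₈ input.**
[cite: ConnesConsani2021, §6.4 Fact 6.1 + Lemma 6.3 p. 24 (in-kernel (E-a) certificate); §6.3 p. 24] -/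
theorem tier2_hM_of_exists (s8 : ℕ → IPoly)
    (hP : ∀ K < 64, subSups (tsubI (sigmaTM K) (s8 K)) = panelM.getD K [])
    (hσ : ∀ K < 64, TMem S hQ (fun u ↦ 2 * ((twoEt / 2 : ℚ) : ℝ) * (tauC (cK K + u)).re) (sigmaTM K))
    (h8 : ∀ K < 64, ∃ E : ℝ → ℝ, TMem S hQ E (s8 K) ∧
      ∀ u : ℝ, 0 ≤ cK K + u → cK K + u ≤ Real.log 2 → E u = S8 (Real.exp (cK K + u))) :
    ∀ k : ℕ, k < 2048 → ∀ w ∈ Icc ((k : ℝ) * Real.log 2 / 2048) (((k + 1 : ℕ) : ℝ) * Real.log 2 / 2048),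
      |2 * ((twoEt / 2 : ℚ) : ℝ) * (tauC w).re - S8 (Real.exp w)| ≤ (panelMQ k : ℝ) :=
  hM_of_subSups_exists s8 panelM hP hσ h8

/-- **End-to-end form of the S₈ input for the panels of record**: if `s8TM hQ 6 (centre K) combinedLit = some (s8 K)`
for every `K < 64` (the sixteen landed kernel-check modules give `panelSups combinedLit K = some panelM[K]`, hence
this), then, under the per-mode identification / enclosure / truncation hypotheses of `tmem_s8TM_sonine`, the family
`s8` satisfies the ∃E hypothesis `h8` of `tier2_hM_of_exists`.
[cite: ConnesConsani2021, §5 eq. (99) p. 32; §6.3–6.4 p. 24 (in-kernel (E-a) certificate)] -/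
theorem h8_of_s8TM (s8 : ℕ → IPoly) (h8P : ∀ K < 64, s8TM hQ 6 (centre K) combinedLit = some (s8 K))
    {b t : ℕ → ℝ} {f g : ℕ → ℕ → ℝ}
    (hBc : ∀ n, n < 8 → frobSol₁ 1 (b n) 0 = 0) (hid : ∀ n, n < 8 → prolateFun n = frobEvenExt (b n))
    (ht : ∀ n, n < 8 → t n = epsSlopeTerm (prolateFun n))
    (hC : ∀ i < 24, ∀ j < 34,
      MI.mem S (∑ n ∈ range 8, t n * g n i * f n j * ((i ! * j ! : ℝ) / (i + j + 1)!))
        ((combinedLit.C.getD i []).getD j zeroI))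
    (hFs : ∀ j < 34, MI.mem S (∑ n ∈ range 8, t n * f n j) (combinedLit.cFs.getD j zeroI))
    (hFu : ∀ i < 24, MI.mem S (∑ n ∈ range 8, t n * f n i) (combinedLit.cFu.getD i zeroI))
    {δG δi δo A B : ℕ → ℝ}
    (hGd : ∀ n, n < 8 → ∀ x ∈ Icc (1 / 2 : ℝ) 1,
      |x ^ 2 * frobSol₁ 1 (b n) x + ∑ i ∈ range 24, g n i * (1 - x) ^ i| ≤ δG n)
    (hFi : ∀ n, n < 8 → ∀ x ∈ Icc (1 / 2 : ℝ) 1,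
      |frobSol₁ 1 (b n) x + ∑ i ∈ range 24, f n i * (1 - x) ^ i| ≤ δi n)
    (hGs : ∀ n, n < 8 → ∀ x ∈ Icc (1 / 2 : ℝ) 1, |∑ i ∈ range 24, g n i * (1 - x) ^ i| ≤ B n)
    (hFo : ∀ n, n < 8 → ∀ y ∈ Icc (1 : ℝ) 2,
      |frobSol₁ 1 (b n) y + ∑ j ∈ range 34, f n j * (1 - y) ^ j| ≤ δo n)
    (hA : ∀ n, n < 8 → ∀ y ∈ Icc (1 : ℝ) 2, |frobSol₁ 1 (b n) y| ≤ A n)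
    (hW : ∑ n ∈ range 8, t n * (Real.sqrt 2 * (δG n * A n + B n * δo n) + δi n + 2 * Real.sqrt 2 * δo n)
      ≤ (combinedLit.W : ℝ) / S) :
    ∀ K < 64, ∃ E : ℝ → ℝ, TMem S hQ E (s8 K) ∧
      ∀ u : ℝ, 0 ≤ cK K + u → cK K + u ≤ Real.log 2 → E u = S8 (Real.exp (cK K + u)) :=
  fun K hK ↦ tmem_s8TM_sonine K (h8P K hK) hBc hid ht hC hFs hFu hGd hFi hGs hFo hA hW

end Assembly

end Literature.NumberTheory.ConnesConsani2021.ArchCertT2
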